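import Literature.Analysis.FluidPDE.TruncatedNewtonHessian
import Literature.Analysis.FluidPDE.NSStrongSpeedBound
import Literature.Analysis.FluidPDE.VectorCalculusProofs
import HarnessLib

/-!
# The local representation of the velocity gradient by the vorticity (local Biot–Savart law)

Analysis/FluidPDE support file, second brick of the discharge of Tao 2011, §10, the nonlinear
estimate for `Y₆` (`NS.tao2011_nonlinearEstimate`). Tao (arXiv:1108.1165, p. 32): "The first
step is to convert `∇u` into an expression that only involves `ω` (modulo lower order terms),
while staying inside the domain `Ω`. … `Δu = ∇ × ∇ × u = ∇ × ω`. Let `ψᵢ` be a smooth cutoff …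
we thus have the local Biot–Savart law `u = O(Δ⁻¹∇(ψᵢω)) + v` where `v` is harmonic on `2Bᵢ` …
`|∇u| ≲ |∇Δ⁻¹∇(ψᵢω)| + r_i^{-3/2}‖ω‖_{L²(2Bᵢ)} + r_i^{-5/2}‖u‖_{L²(2Bᵢ)}` on `Bᵢ`." Here the
harmonic remainder is replaced by the explicit far-field kernel `λ = Δ((1−θ)Γ)` of the truncated
Newton kernel (`NewtonKernel`, `NewtonPotential`), which gives the same two bounds without any
theory of harmonic functions:

* `laplacian_comp_eq_sum_pderiv_vortComp` — `Δuₘ = Σⱼ∂ⱼΩⱼₘ` (`Ωⱼₘ = ∂ⱼuₘ − ∂ₘuⱼ`, the tree's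
  `vortComp`) for smooth divergence-free `u`;
* `pderiv_velocity_eq_near_add_far` — **`∂ₖuₘ(x) = Σⱼ ∂ₖ∂ⱼ(Γ₀^{ρ,2ρ} ⋆ (ψΩⱼₘ))(x) + ∫ λ^{ρ,2ρ}(z)∂ₖuₘ(x+z) dz`**
  for `ψ ∈ C_c^∞` equal to `1` on `B(x, 2ρ)` (Green's representation of `z ↦ ∂ₖuₘ(x + z)`,
  locality of `Γ₀`, derivatives moved onto `ψΩ`);
* `eLpNorm_pderiv_pderiv_convolution_newtonNear_le` — each near term has
  `‖·‖_{L²} ≤ (1 + ‖λ^{1,2}‖_{L¹})‖ψΩⱼₘ‖_{L²}` (Tao's "Plancherel" step, `TruncatedNewtonHessian`);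
  `sum_sum_vortComp_sq_eq` — `ΣⱼΣₘΩⱼₘ² = 2|ω|²`;
* the far-field term: `integral_newtonFarLaplacian_mul_pderiv_comp_add` (integration by parts),
  `abs_integral_newtonFarLaplacian_mul_pderiv_le_speed` (`≤ s∫|∂ₖλ|` when `|uₘ| ≤ s`, Tao's
  "`r^{-3/2}‖u‖_{L²(2Bᵢ)} ≲ ‖u‖_{L^∞}`"), `abs_integral_newtonFarLaplacian_mul_pderiv_le_energy`
  (`≤ ‖∂ₖλ‖₂ ‖uₘ‖_{L²(B̄(x,2ρ))}`, Tao's "`r_i^{-5/2}‖u‖_{L²(2Bᵢ)}`"), and the scalings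
  `∫|∂ₖλ^{c,2c}| = c⁻¹∫|∂ₖλ^{1,2}|`, `∫|∂ₖλ^{c,2c}|² = c⁻⁵∫|∂ₖλ^{1,2}|²`.

## Mathlib / tree search

Tree: `integral_newtonNear_mul_laplacian`, `newtonFarLaplacian_scale`,
`tsupport_newtonFarLaplacian_subset_annulus` (`NewtonPotential`/`NewtonKernel`), `vortComp`,
`pderiv`, `pderiv_comm`, `IsDivFree.sum_pderiv_comp_eq_zero`, `vortSq_zero_eq_frobeniusNormSq_spin`
(`CoordDerivatives`), `laplacian_eq_sum_pderiv_pderiv` (`NSStrongSpeedBound`),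
`norm_curl_sq_eq_frobeniusNormSq_spin_holds` (`VectorCalculusProofs`), `fderiv_laplacian_apply`,
`integral_mul_fderiv_apply_eq_neg`, `integral_norm_mul_norm_le_sqrt_mul_sqrt` (`EnergyToolkit`).
Mathlib: `Filter.EventuallyEq.fderiv`, `fderiv_comp_add_left`, `Integrable.bdd_mul`,
`Measure.integral_comp_smul`, `memLp_two_iff_integrable_sq`.

## References

* T. Tao, arXiv:1108.1165 (`Tao2011`), §10, proof of Thm. 10.1 (p. 32, the local Biot–Savart law
  and the terms `Y₆,₁`, `Y₆,₂`).
* D. Gilbarg, N. Trudinger, *Elliptic PDE of second order*, (2.16)–(2.17).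
-/

noncomputable section

open MeasureTheory Set Function Filter Metric
open scoped ENNReal NNReal Topology Laplacian Convolution ContDiff

namespace Literature.Analysis.FluidPDE


section LocalGradient

/-- **`Δuₘ = Σⱼ ∂ⱼΩⱼₘ` for a smooth divergence-free field** (`Ωⱼₘ = ∂ⱼuₘ − ∂ₘuⱼ` the vorticity
matrix, `NS.vortComp`): `Σⱼ∂ⱼ(∂ⱼuₘ − ∂ₘuⱼ) = Σⱼ∂ⱼ∂ⱼuₘ − ∂ₘ(Σⱼ∂ⱼuⱼ) = Δuₘ` by Schwarz and
`div u = 0` — the identity "`Δu = ∇ × ∇ × u = ∇ × ω`" (Tao 2011 p. 32, up to sign conventions) in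
coordinates. [cite: Tao2011, §10, proof of Thm. 10.1 (local Biot–Savart law)] -/
theorem laplacian_comp_eq_sum_pderiv_vortComp
    {u : EuclideanSpace ℝ (Fin 3) → EuclideanSpace ℝ (Fin 3)} (hu : ContDiff ℝ ∞ u)
    (hdiv : VectorCalculus.IsDivFree u) (x : EuclideanSpace ℝ (Fin 3)) (m : Fin 3) :
    (Δ (fun y => u y m)) x = ∑ j, pderiv j (vortComp u j m) x := by
  have hum : ∀ i, ContDiff ℝ ∞ fun y => u y i := fun i => contDiff_euclidean.1 hu i
  have hpd : ∀ i l, Differentiable ℝ (pderiv l fun y => u y i) := fun i l =>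
    (contDiff_pderiv (hum i) l).differentiable (by simp)
  rw [laplacian_eq_sum_pderiv_pderiv ((hum m).of_le (by norm_cast)) x]
  -- expand the vorticity matrix and split the sum
  have hsplit : ∀ j, pderiv j (vortComp u j m) x =
      pderiv j (pderiv j fun y => u y m) x - pderiv m (pderiv j fun y => u y j) x := by
    intro j
    have e : vortComp u j m = fun y => pderiv j (fun z => u z m) y - pderiv m (fun z => u z j) y := rfl
    rw [e, pderiv_sub (hpd m j) (hpd j m), pderiv_comm (hum j) j m]
  simp_rw [hsplit]
  rw [Finset.sum_sub_distrib]
  -- the second sum is `∂ₘ(div u) = 0`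
  have hdiv0 : (fun y => ∑ j, pderiv j (fun z => u z j) y) = fun _ => (0 : ℝ) :=
    funext fun y => hdiv.sum_pderiv_comp_eq_zero (hu.differentiable (by simp)) y
  have hsum : ∑ j, pderiv m (pderiv j fun y => u y j) x =
      pderiv m (fun y => ∑ j, pderiv j (fun z => u z j) y) x := by
    rw [pderiv_sum Finset.univ (fun j _ => hpd j j) m]
  rw [hsum, hdiv0, pderiv_const]
  simp

/-- **Local representation of the velocity gradient** (the tree's form of Tao's local
Biot–Savart law "`u = O(Δ⁻¹∇(ψᵢω)) + v` where `v` is harmonic on `2Bᵢ`", p. 32). For a smooth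
divergence-free `u` on `ℝ³`, a scale `ρ > 0` (truncated Newton kernel `Γ₀ = Γ₀^{ρ,2ρ}`, far
Laplacian `λ = λ^{ρ,2ρ}`), a smooth compactly supported `ψ` equal to `1` on the ball `B(x, 2ρ)`,
and coordinates `k, m`:
`∂ₖuₘ(x) = Σⱼ ∂ₖ∂ⱼ(Γ₀ ⋆ (ψΩⱼₘ))(x) + ∫ λ(z) ∂ₖuₘ(x + z) dz`
— Green's representation (`integral_newtonNear_mul_laplacian`) of the `C²` function
`z ↦ ∂ₖuₘ(x + z)`, with `Δ∂ₖuₘ = ∂ₖΔuₘ = Σⱼ∂ₖ∂ⱼΩⱼₘ` (`laplacian_comp_eq_sum_pderiv_vortComp`),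
the locality of `Γ₀` (supported in `|z| ≤ 2ρ`, where `ψ = 1`) and derivatives moved onto the
compactly supported factor (`fderiv_fderiv_convolution_newtonNear_apply`). The first term only
sees the vorticity near `x` and is bounded in `L²` by `(1 + ‖λ‖₁)‖ψΩ‖₂`
(`eLpNorm_fderiv_fderiv_convolution_newtonNear_le`); the second is the smooth far-field part.
[cite: Tao2011, §10, proof of Thm. 10.1 (local Biot–Savart law)] -/
theorem pderiv_velocity_eq_near_add_far
    {u : EuclideanSpace ℝ (Fin 3) → EuclideanSpace ℝ (Fin 3)} (hu : ContDiff ℝ ∞ u)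
    (hdiv : VectorCalculus.IsDivFree u) {ρ : ℝ} (hρ : 0 < ρ)
    {ψ : EuclideanSpace ℝ (Fin 3) → ℝ} (hψ : ContDiff ℝ ∞ ψ) (hψc : HasCompactSupport ψ)
    {x : EuclideanSpace ℝ (Fin 3)} (hψ1 : ∀ y ∈ ball x (2 * ρ), ψ y = 1) (k m : Fin 3) :
    pderiv k (fun y => u y m) x =
      (∑ j, pderiv k (pderiv j (newtonNear ρ (2 * ρ) ⋆[ContinuousLinearMap.lsmul ℝ ℝ, volume]
          (fun y => ψ y * vortComp u j m y))) x) +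
        ∫ z, newtonFarLaplacian ρ (2 * ρ) z * pderiv k (fun y => u y m) (x + z) := by
  have hρ2 : ρ < 2 * ρ := by linarith
  have hum : ∀ i, ContDiff ℝ ∞ fun y => u y i := fun i => contDiff_euclidean.1 hu i
  set f : EuclideanSpace ℝ (Fin 3) → ℝ := fun y => u y m with hf
  have hfs : ContDiff ℝ ∞ f := hum m
  have hpk : ContDiff ℝ ∞ (pderiv k f) := contDiff_pderiv hfs k
  -- the vorticity matrix entries and their localisations are smooth (with compact support)
  have hΩ : ∀ j, ContDiff ℝ ∞ (vortComp u j m) := fun j =>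
    (contDiff_pderiv (hum m) j).sub (contDiff_pderiv (hum j) m)
  have hg : ∀ j, ContDiff ℝ ∞ (fun y => ψ y * vortComp u j m y) := fun j => hψ.mul (hΩ j)
  have hgc : ∀ j, HasCompactSupport (fun y => ψ y * vortComp u j m y) := fun j => hψc.mul_right
  -- Green's representation for `φ(z) = ∂ₖuₘ(x + z)`
  set φ : EuclideanSpace ℝ (Fin 3) → ℝ := fun z => pderiv k f (x + z) with hφ
  have hφ2 : ContDiff ℝ 2 φ := (hpk.of_le (by norm_cast)).comp (contDiff_const.add contDiff_id)
  have hGreen := integral_newtonNear_mul_laplacian hρ hρ2 hφ2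
  have hφ0 : φ 0 = pderiv k f x := by simp [hφ]
  -- `Δφ(z) = Σⱼ ∂ₖ∂ⱼΩⱼₘ(x + z)`
  have hΔφ : ∀ z, (Δ φ) z = ∑ j, pderiv k (pderiv j (vortComp u j m)) (x + z) := by
    intro z
    rw [hφ, laplacian_comp_const_add (pderiv k f) x z]
    -- `Δ(∂ₖf) = ∂ₖ(Δf)` and `Δf = Σⱼ∂ⱼΩⱼₘ`
    have h1 : (Δ (pderiv k f)) (x + z) = pderiv k (Δ f) (x + z) := by
      rw [pderiv_apply, fderiv_laplacian_apply (hfs.of_le (by norm_cast)) (x + z) (stdVec k)]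
      rfl
    have h2 : (Δ f) = fun w => ∑ j, pderiv j (vortComp u j m) w :=
      funext fun w => laplacian_comp_eq_sum_pderiv_vortComp hu hdiv w m
    rw [h1, h2, pderiv_sum Finset.univ (fun j _ =>
      (contDiff_pderiv (hΩ j) j).differentiable (by simp)) k]
  -- localisation: on the support of `Γ₀` the derivatives of `Ωⱼₘ` are those of `ψΩⱼₘ`
  have hloc : ∀ j z, newtonNear ρ (2 * ρ) z * pderiv k (pderiv j (vortComp u j m)) (x + z) =
      newtonNear ρ (2 * ρ) z * pderiv k (pderiv j fun y => ψ y * vortComp u j m y) (x + z) := by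
    intro j z
    by_cases hz : ‖z‖ < 2 * ρ
    · -- `ψΩ = Ω` near `x + z`, hence so are the iterated partial derivatives
      have hmem : x + z ∈ ball x (2 * ρ) := by
        rw [mem_ball, dist_eq_norm, add_sub_cancel_left]; exact hz
      have hev : (fun y => ψ y * vortComp u j m y) =ᶠ[𝓝 (x + z)] vortComp u j m := by
        filter_upwards [isOpen_ball.mem_nhds hmem] with y hy
        rw [hψ1 y hy, one_mul]
      have hev1 : pderiv j (fun y => ψ y * vortComp u j m y) =ᶠ[𝓝 (x + z)] pderiv j (vortComp u j m) := by
        filter_upwards [hev.fderiv (𝕜 := ℝ)] with y hy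
        rw [pderiv_apply, pderiv_apply, hy]
      have hev2 : pderiv k (pderiv j fun y => ψ y * vortComp u j m y) (x + z) =
          pderiv k (pderiv j (vortComp u j m)) (x + z) := by
        rw [pderiv_apply, pderiv_apply, hev1.fderiv_eq]
      rw [hev2]
    · rw [newtonNear_eq_zero hρ.le hρ2 (not_lt.1 hz), zero_mul, zero_mul]
  -- the localised integrands are integrable (`Γ₀ ∈ L¹` times a bounded continuous function)
  have hG : ∀ j, ContDiff ℝ ∞ (pderiv k (pderiv j fun y => ψ y * vortComp u j m y)) := fun j =>
    contDiff_pderiv (contDiff_pderiv (hg j) j) k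
  have hGc : ∀ j, HasCompactSupport (pderiv k (pderiv j fun y => ψ y * vortComp u j m y)) := fun j =>
    ((hgc j).fderiv_apply (𝕜 := ℝ) (stdVec j)).fderiv_apply (𝕜 := ℝ) (stdVec k)
  have hint : ∀ j, Integrable fun z => newtonNear ρ (2 * ρ) z *
      pderiv k (pderiv j (vortComp u j m)) (x + z) := by
    intro j
    obtain ⟨C, hC⟩ := (hGc j).exists_bound_of_continuous (hG j).continuous
    have hi : Integrable fun z => pderiv k (pderiv j fun y => ψ y * vortComp u j m y) (x + z) *
        newtonNear ρ (2 * ρ) z :=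
      (integrable_newtonNear hρ.le hρ2).bdd_mul
        (((hG j).continuous.comp (continuous_const.add continuous_id)).aestronglyMeasurable)
        (Eventually.of_forall fun z => hC _)
    refine (hi.congr (Eventually.of_forall fun z => ?_))
    change pderiv k (pderiv j fun y => ψ y * vortComp u j m y) (x + z) * newtonNear ρ (2 * ρ) z =
      newtonNear ρ (2 * ρ) z * pderiv k (pderiv j (vortComp u j m)) (x + z)
    rw [mul_comm]
    exact (hloc j z).symm
  -- the near integral, term by term
  have hnear : ∫ z, newtonNear ρ (2 * ρ) z * (Δ φ) z =
      ∑ j, pderiv k (pderiv j (newtonNear ρ (2 * ρ) ⋆[ContinuousLinearMap.lsmul ℝ ℝ, volume]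
          (fun y => ψ y * vortComp u j m y))) x := by
    simp_rw [hΔφ, Finset.mul_sum]
    rw [integral_finsetSum _ fun j _ => hint j]
    refine Finset.sum_congr rfl fun j _ => ?_
    simp_rw [hloc j]
    -- `∫ Γ₀(z) G(x + z) dz = (Γ₀ ⋆ G)(x) = ∂ₖ∂ⱼ(Γ₀ ⋆ g)(x)`
    have hconv : ∫ z, newtonNear ρ (2 * ρ) z * pderiv k (pderiv j fun y => ψ y * vortComp u j m y) (x + z) =
        (newtonNear ρ (2 * ρ) ⋆[ContinuousLinearMap.lsmul ℝ ℝ, volume]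
          (pderiv k (pderiv j fun y => ψ y * vortComp u j m y))) x := by
      simp only [convolution_def, ContinuousLinearMap.lsmul_apply, smul_eq_mul]
      rw [← integral_neg_eq_self]
      refine integral_congr_ae (Eventually.of_forall fun z => ?_)
      dsimp only
      rw [newtonNear_neg, ← sub_eq_add_neg]
    rw [hconv]
    simp only [pderiv_eq]
    rw [fderiv_fderiv_convolution_newtonNear_apply hρ hρ2 ((hg j).of_le (by norm_cast)) (hgc j) x
        (stdVec j) (stdVec k)]
  have hrep : φ 0 = (∫ z, newtonNear ρ (2 * ρ) z * (Δ φ) z) +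
      ∫ z, newtonFarLaplacian ρ (2 * ρ) z * φ z := by linarith [hGreen]
  rw [← hφ0, hrep, hnear]

/-! ### The far-field term: integration by parts and bounds -/

/-- **Integration by parts in the far-field term**: for `f ∈ C¹` and `0 < ρ`,
`∫ λ(z) ∂ₖf(x + z) dz = −∫ ∂ₖλ(z) f(x + z) dz` (`λ = λ^{ρ,2ρ}` is smooth with compact support).
[folklore] -/
theorem integral_newtonFarLaplacian_mul_pderiv_comp_add {ρ : ℝ} (hρ : 0 < ρ)
    {f : EuclideanSpace ℝ (Fin 3) → ℝ} (hf : ContDiff ℝ 1 f) (x : EuclideanSpace ℝ (Fin 3)) (k : Fin 3) :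
    ∫ z, newtonFarLaplacian ρ (2 * ρ) z * pderiv k f (x + z) =
      -∫ z, pderiv k (newtonFarLaplacian ρ (2 * ρ)) z * f (x + z) := by
  have hρ2 : ρ < 2 * ρ := by linarith
  set Ψ : EuclideanSpace ℝ (Fin 3) → ℝ := fun z => f (x + z) with hΨ
  have hΨ1 : ContDiff ℝ 1 Ψ := hf.comp (contDiff_const.add contDiff_id)
  have hlam1 : ContDiff ℝ 1 (newtonFarLaplacian ρ (2 * ρ)) := contDiff_newtonFarLaplacian hρ hρ2 (n := 1)
  have hibp := integral_mul_fderiv_apply_eq_neg hΨ1 hlam1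
    (hasCompactSupport_newtonFarLaplacian hρ.le hρ2) (stdVec k)
  -- `∂ₖΨ(z) = ∂ₖf(x + z)`
  have hdΨ : ∀ z, fderiv ℝ Ψ z (stdVec k) = pderiv k f (x + z) := fun z => by
    rw [hΨ, pderiv_apply, fderiv_comp_add_left]
  have e1 : ∫ z, newtonFarLaplacian ρ (2 * ρ) z * pderiv k f (x + z) =
      ∫ z, fderiv ℝ Ψ z (stdVec k) * newtonFarLaplacian ρ (2 * ρ) z :=
    integral_congr_ae (Eventually.of_forall fun z => by dsimp only; rw [hdΨ, mul_comm])
  have e2 : ∫ z, pderiv k (newtonFarLaplacian ρ (2 * ρ)) z * f (x + z) =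
      ∫ z, Ψ z * fderiv ℝ (newtonFarLaplacian ρ (2 * ρ)) z (stdVec k) :=
    integral_congr_ae (Eventually.of_forall fun z => by dsimp only; rw [pderiv_apply, hΨ, mul_comm])
  rw [e1, e2, hibp, neg_neg]

/-- **Far-field bound by the speed** ("we use Hölder to bound `r^{-3/2}‖u‖_{L²(2Bᵢ)} ≲ ‖u‖_{L^∞}`",
Tao 2011 p. 32): if `|f| ≤ s` pointwise then `|∫ λ(z)∂ₖf(x + z) dz| ≤ s ∫|∂ₖλ|`. [cite: Tao2011, §10, proof of Thm. 10.1 (the term Y₆,₂)] -/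
theorem abs_integral_newtonFarLaplacian_mul_pderiv_le_speed {ρ : ℝ} (hρ : 0 < ρ)
    {f : EuclideanSpace ℝ (Fin 3) → ℝ} (hf : ContDiff ℝ 1 f) {s : ℝ} (hs : ∀ y, |f y| ≤ s)
    (x : EuclideanSpace ℝ (Fin 3)) (k : Fin 3) :
    |∫ z, newtonFarLaplacian ρ (2 * ρ) z * pderiv k f (x + z)| ≤
      s * ∫ z, |pderiv k (newtonFarLaplacian ρ (2 * ρ)) z| := by
  have hρ2 : ρ < 2 * ρ := by linarith
  have hs0 : 0 ≤ s := (abs_nonneg _).trans (hs x)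
  rw [integral_newtonFarLaplacian_mul_pderiv_comp_add hρ hf x k, abs_neg]
  have hlam : ContDiff ℝ ∞ (newtonFarLaplacian ρ (2 * ρ)) := contDiff_newtonFarLaplacian hρ hρ2
  have hdc : Continuous (pderiv k (newtonFarLaplacian ρ (2 * ρ))) := (contDiff_pderiv hlam k).continuous
  have hdcs : HasCompactSupport (pderiv k (newtonFarLaplacian ρ (2 * ρ))) :=
    (hasCompactSupport_newtonFarLaplacian hρ.le hρ2).fderiv_apply (𝕜 := ℝ) (stdVec k)
  have hint : Integrable fun z => |pderiv k (newtonFarLaplacian ρ (2 * ρ)) z| :=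
    (hdc.abs).integrable_of_hasCompactSupport hdcs.abs
  calc |∫ z, pderiv k (newtonFarLaplacian ρ (2 * ρ)) z * f (x + z)|
      ≤ ∫ z, |pderiv k (newtonFarLaplacian ρ (2 * ρ)) z * f (x + z)| := abs_integral_le_integral_abs
    _ ≤ ∫ z, |pderiv k (newtonFarLaplacian ρ (2 * ρ)) z| * s := by
        refine integral_mono_of_nonneg (Eventually.of_forall fun z => abs_nonneg _) (hint.mul_const s)
          (Eventually.of_forall fun z => ?_)
        dsimp only
        rw [abs_mul]
        exact mul_le_mul_of_nonneg_left (hs _) (abs_nonneg _)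
    _ = s * ∫ z, |pderiv k (newtonFarLaplacian ρ (2 * ρ)) z| := by
        rw [integral_mul_const, mul_comm]

/-- **Scaling of the far-field gradient**: `∂ₖλ^{c,2c}(z) = c⁻⁴ (∂ₖλ^{1,2})(c⁻¹z)`. [folklore] -/
theorem pderiv_newtonFarLaplacian_scale {c : ℝ} (hc : 0 < c) (k : Fin 3) (z : EuclideanSpace ℝ (Fin 3)) :
    pderiv k (newtonFarLaplacian (c * 1) (c * 2)) z =
      c⁻¹ ^ 4 * pderiv k (newtonFarLaplacian 1 2) (c⁻¹ • z) := by
  have hfun : newtonFarLaplacian (c * 1) (c * 2) =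
      fun z => c⁻¹ ^ 3 * newtonFarLaplacian 1 2 (c⁻¹ • z) := funext (newtonFarLaplacian_scale hc 1 2)
  rw [pderiv_apply, hfun]
  have hd : DifferentiableAt ℝ (newtonFarLaplacian 1 2) (c⁻¹ • z) :=
    ((contDiff_newtonFarLaplacian one_pos one_lt_two (n := 1)).differentiable (by norm_num)) _
  have hA : HasFDerivAt (fun w : EuclideanSpace ℝ (Fin 3) => c⁻¹ • w)
      (c⁻¹ • ContinuousLinearMap.id ℝ (EuclideanSpace ℝ (Fin 3))) z := (hasFDerivAt_id z).const_smul c⁻¹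
  have hB : HasFDerivAt (fun w : EuclideanSpace ℝ (Fin 3) => newtonFarLaplacian 1 2 (c⁻¹ • w))
      ((fderiv ℝ (newtonFarLaplacian 1 2) (c⁻¹ • z)).comp
        (c⁻¹ • ContinuousLinearMap.id ℝ (EuclideanSpace ℝ (Fin 3)))) z := hd.hasFDerivAt.comp z hA
  have hC : HasFDerivAt (fun w : EuclideanSpace ℝ (Fin 3) => c⁻¹ ^ 3 * newtonFarLaplacian 1 2 (c⁻¹ • w))
      (c⁻¹ ^ 3 • (fderiv ℝ (newtonFarLaplacian 1 2) (c⁻¹ • z)).comp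
        (c⁻¹ • ContinuousLinearMap.id ℝ (EuclideanSpace ℝ (Fin 3)))) z := hB.const_mul (c⁻¹ ^ 3)
  rw [hC.fderiv, pderiv_apply]
  simp only [FunLike.coe_smul, Pi.smul_apply, ContinuousLinearMap.coe_comp, comp_apply,
    ContinuousLinearMap.coe_id', id_eq, map_smul, smul_eq_mul]
  ring

/-! ### The near term: `L²` bound in coordinate form -/

/-- **`L²` bound on the near term of the local representation**: for `g ∈ C_c^∞` and
coordinates `j, k`, `‖∂ₖ∂ⱼ(Γ₀^{ρ,2ρ} ⋆ g)‖_{L²} ≤ (1 + ‖λ^{1,2}‖_{L¹}) ‖g‖_{L²}` — the Hessian bound of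
`TruncatedNewtonHessian.lean` in `pderiv` form, with the scale-invariant constant. [cite: Tao2011, §10, proof of Thm. 10.1 (local Biot–Savart law, Plancherel step)] -/
theorem eLpNorm_pderiv_pderiv_convolution_newtonNear_le {ρ : ℝ} (hρ : 0 < ρ)
    {g : EuclideanSpace ℝ (Fin 3) → ℝ} (hg : ContDiff ℝ ∞ g) (hgc : HasCompactSupport g) (j k : Fin 3) :
    eLpNorm (pderiv k (pderiv j (newtonNear ρ (2 * ρ) ⋆[ContinuousLinearMap.lsmul ℝ ℝ, volume] g))) 2 volume ≤
      (1 + ∫⁻ z, ‖newtonFarLaplacian 1 2 z‖ₑ) * eLpNorm g 2 volume := by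
  have hρ2 : ρ < 2 * ρ := by linarith
  have h := eLpNorm_fderiv_fderiv_convolution_newtonNear_le hρ hρ2 hg hgc j k
  have hscale : ∫⁻ z, ‖newtonFarLaplacian ρ (2 * ρ) z‖ₑ = ∫⁻ z, ‖newtonFarLaplacian 1 2 z‖ₑ := by
    have := lintegral_enorm_newtonFarLaplacian_scale hρ 1 2
    rwa [mul_one, show ρ * 2 = 2 * ρ by ring] at this
  rw [hscale] at h
  have hfun : pderiv k (pderiv j (newtonNear ρ (2 * ρ) ⋆[ContinuousLinearMap.lsmul ℝ ℝ, volume] g)) =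
      fun x => fderiv ℝ (fun y => fderiv ℝ (newtonNear ρ (2 * ρ) ⋆[ContinuousLinearMap.lsmul ℝ ℝ, volume] g) y
        (EuclideanSpace.basisFun (Fin 3) ℝ j)) x (EuclideanSpace.basisFun (Fin 3) ℝ k) := by
    funext x
    rw [pderiv_apply, pderiv_eq, stdVec_eq_basisFun, stdVec_eq_basisFun]
  rw [hfun]
  exact h

/-- **The vorticity matrix is comparable to the curl**: `Σⱼ Σₘ Ωⱼₘ(x)² = 2 ‖curl u (x)‖²` for
`u` differentiable at `x` (`vortSq_zero_eq_frobeniusNormSq_spin`, `norm_curl_sq_eq_frobeniusNormSq_spin`).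
[folklore] -/
theorem sum_sum_vortComp_sq_eq {u : EuclideanSpace ℝ (Fin 3) → EuclideanSpace ℝ (Fin 3)}
    {x : EuclideanSpace ℝ (Fin 3)} (hu : DifferentiableAt ℝ u x) :
    ∑ j, ∑ m, vortComp u j m x ^ 2 = 2 * ‖FluidPDE.curl u x‖ ^ 2 := by
  have h1 := vortSq_zero_eq_frobeniusNormSq_spin hu
  have h2 := norm_curl_sq_eq_frobeniusNormSq_spin_holds u x hu
  simp only [vortSq, dnormSq_zero] at h1
  rw [h1, h2]
  ring


/-! ### Far-field bound by the local energy, and the scalings of `∫|∂ₖλ|`, `∫|∂ₖλ|²` -/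

/-- **Far-field bound by the local energy** ("`‖∇v‖_{L^∞(Bᵢ)} ≲ r_i^{-5/2}‖v‖_{L²(2Bᵢ)}`", Tao
2011 p. 32, here without harmonic functions): since `∂ₖλ^{ρ,2ρ}` is supported in `|z| ≤ 2ρ`,
`|∫ λ(z)∂ₖf(x + z) dz| ≤ (∫|∂ₖλ|²)^{1/2} (∫_{|z|≤2ρ} f(x + z)²)^{1/2}` (Cauchy–Schwarz). [cite: Tao2011, §10, proof of Thm. 10.1 (the term Y₆,₂)] -/
theorem abs_integral_newtonFarLaplacian_mul_pderiv_le_energy {ρ : ℝ} (hρ : 0 < ρ)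
    {f : EuclideanSpace ℝ (Fin 3) → ℝ} (hf : ContDiff ℝ 1 f) (x : EuclideanSpace ℝ (Fin 3)) (k : Fin 3) :
    |∫ z, newtonFarLaplacian ρ (2 * ρ) z * pderiv k f (x + z)| ≤
      Real.sqrt (∫ z, pderiv k (newtonFarLaplacian ρ (2 * ρ)) z ^ 2) *
        Real.sqrt (∫ z in closedBall (0 : EuclideanSpace ℝ (Fin 3)) (2 * ρ), f (x + z) ^ 2) := by
  have hρ2 : ρ < 2 * ρ := by linarith
  rw [integral_newtonFarLaplacian_mul_pderiv_comp_add hρ hf x k, abs_neg]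
  set K : Set (EuclideanSpace ℝ (Fin 3)) := closedBall 0 (2 * ρ) with hK
  have hKm : MeasurableSet K := measurableSet_closedBall
  have hlam : ContDiff ℝ ∞ (newtonFarLaplacian ρ (2 * ρ)) := contDiff_newtonFarLaplacian hρ hρ2
  set D : EuclideanSpace ℝ (Fin 3) → ℝ := pderiv k (newtonFarLaplacian ρ (2 * ρ)) with hD
  have hDc : Continuous D := (contDiff_pderiv hlam k).continuous
  have hDcs : HasCompactSupport D :=
    (hasCompactSupport_newtonFarLaplacian hρ.le hρ2).fderiv_apply (𝕜 := ℝ) (stdVec k)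
  -- `∂ₖλ` vanishes off `K`
  have hDsupp : ∀ z ∉ K, D z = 0 := by
    intro z hz
    have hz' : z ∉ tsupport (newtonFarLaplacian ρ (2 * ρ)) := fun h =>
      hz ((tsupport_newtonFarLaplacian_subset_annulus hρ.le hρ2 h).1)
    rw [hD, pderiv_apply, fderiv_of_notMem_tsupport (𝕜 := ℝ) hz', _root_.zero_apply]
  -- replace `f(x + ·)` by its restriction to `K`
  set g : EuclideanSpace ℝ (Fin 3) → ℝ := K.indicator fun z => f (x + z) with hg
  have heq : ∀ z, D z * f (x + z) = D z * g z := by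
    intro z
    by_cases hz : z ∈ K
    · rw [hg, indicator_of_mem hz]
    · rw [hDsupp z hz, zero_mul, zero_mul]
  have hfc : Continuous fun z => f (x + z) := hf.continuous.comp (continuous_const.add continuous_id)
  have hDmem : MemLp D 2 (volume : Measure (EuclideanSpace ℝ (Fin 3))) :=
    hDc.memLp_of_hasCompactSupport hDcs
  have hgm : AEStronglyMeasurable g volume := (hfc.aestronglyMeasurable).indicator hKm
  have hgsq : Integrable (fun z => g z ^ 2) := by
    have hi : IntegrableOn (fun z => f (x + z) ^ 2) K volume :=
      (hfc.pow 2).continuousOn.integrableOn_compact (isCompact_closedBall _ _)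
    have := hi.integrable_indicator hKm
    refine this.congr (Eventually.of_forall fun z => ?_)
    by_cases hz : z ∈ K
    · simp [hg, indicator_of_mem hz]
    · simp [hg, indicator_of_notMem hz]
  have hgmem : MemLp g 2 (volume : Measure (EuclideanSpace ℝ (Fin 3))) :=
    (memLp_two_iff_integrable_sq hgm).2 hgsq
  have hCS := FluidPDE.integral_norm_mul_norm_le_sqrt_mul_sqrt hDmem hgmem
  simp only [Real.norm_eq_abs, sq_abs] at hCS
  have hg2 : ∫ z, g z ^ 2 = ∫ z in K, f (x + z) ^ 2 := by
    rw [← integral_indicator hKm]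
    refine integral_congr_ae (Eventually.of_forall fun z => ?_)
    by_cases hz : z ∈ K
    · simp [hg, indicator_of_mem hz]
    · simp [hg, indicator_of_notMem hz]
  rw [hg2] at hCS
  calc |∫ z, D z * f (x + z)| = |∫ z, D z * g z| := by
        rw [integral_congr_ae (Eventually.of_forall heq)]
    _ ≤ ∫ z, |D z * g z| := abs_integral_le_integral_abs
    _ = ∫ z, |D z| * |g z| := integral_congr_ae (Eventually.of_forall fun z => abs_mul _ _)
    _ ≤ _ := hCS

/-- **`∫|∂ₖλ^{c,2c}| = c⁻¹ ∫|∂ₖλ^{1,2}|`.** [folklore] -/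
theorem integral_abs_pderiv_newtonFarLaplacian_scale {c : ℝ} (hc : 0 < c) (k : Fin 3) :
    ∫ z, |pderiv k (newtonFarLaplacian (c * 1) (c * 2)) z| =
      c⁻¹ * ∫ z, |pderiv k (newtonFarLaplacian 1 2) z| := by
  simp_rw [pderiv_newtonFarLaplacian_scale hc k, abs_mul, abs_of_pos (by positivity : (0:ℝ) < c⁻¹ ^ 4)]
  rw [integral_const_mul, Measure.integral_comp_smul volume (fun z => |pderiv k (newtonFarLaplacian 1 2) z|) c⁻¹,
    finrank_euclideanSpace_fin, abs_of_pos (by positivity), smul_eq_mul]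
  field_simp

/-- **`∫|∂ₖλ^{c,2c}|² = c⁻⁵ ∫|∂ₖλ^{1,2}|²`.** [folklore] -/
theorem integral_sq_pderiv_newtonFarLaplacian_scale {c : ℝ} (hc : 0 < c) (k : Fin 3) :
    ∫ z, pderiv k (newtonFarLaplacian (c * 1) (c * 2)) z ^ 2 =
      c⁻¹ ^ 5 * ∫ z, pderiv k (newtonFarLaplacian 1 2) z ^ 2 := by
  simp_rw [pderiv_newtonFarLaplacian_scale hc k, mul_pow]
  rw [integral_const_mul, Measure.integral_comp_smul volume (fun z => pderiv k (newtonFarLaplacian 1 2) z ^ 2) c⁻¹,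
    finrank_euclideanSpace_fin, abs_of_pos (by positivity), smul_eq_mul]
  field_simp


end LocalGradient


end Literature.Analysis.FluidPDE

end
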